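import Summits.MatrixMultiplication.MatrixMultiplication.Theorems.SubgroupIdentityDesigns.Negative.DiagonalRectangles
import Summits.MatrixMultiplication.MatrixMultiplication.Theorems.SubgroupIdentityDesigns.Negative.WitnessPairBound

/-!
# The TORUS BUDGET law for level-1 witnesses (negative lemmas for the crux
# `SubgroupIdentityDesigns`, stmt-MatrixMultiplication-14079) — VALUE = THEOREM (all p), NOT summit
# progress; the crux stays open.

**Torus budget.**  Let `(H₁, H₂, H₃)` be subgroup-TPP in `GL₂(𝔽_p)` with `U⁺ ≤ H₁`, and let
`D₁ ≤ H₁`, `D₂ ≤ H₂` be subgroups of DIAGONAL matrices and `S ≤ H₃` a subgroup of upper-triangular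
matrices.  If the triple carries a level-1 identity test, then

  `|D₁| · |D₂| · |S| ≤ p - 1`            (`torus_budget`, `torus_budget_levelOne`).

This contains the pair bound (L-n2) `|T₁||T₂| ≤ p - 1` of `WitnessPairBound` (take `S = 1`) and the
Borel-part bounds of the kernel law, and multiplies them: for a frame `(U⁺T₁, U⁻T₂, S₃)` it reads
`|T₁| · |T₂| · |S₃ ∩ B⁺| ≤ p - 1`; for one `p`-member `(U⁺T₁, S₂, S₃)` it reads
`|T₁| · |S₂ ∩ T| · |S₃ ∩ B⁺| ≤ p - 1`.

Proof.  The diagonals of the upper-triangular triple products `d₁ d₂ s` form the subgroup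
`G = σ(D₁)σ(D₂)σ(S)` of `𝔽ₚˣ × 𝔽ₚˣ`; every such diagonal carries a whole cell of `H₁H₂H₃`
(`DiagonalRectangles.cell_of_upper_triple`), so the DIAGONAL-SUBGROUP LAW
(`DiagonalRectangles.no_idTest_of_diag_subgroup`) forces `|G| ≤ p - 1`.  The subgroup TPP makes
`(d₁, d₂, s) ↦ σ(d₁ d₂ s)` injective (`diag_triple_injective`: two upper-triangular triple products
with the same diagonal differ by a unitriangular factor, which `U⁺ ≤ H₁` absorbs; diagonal matrices
commute, so the discrepancy is a genuine `H₁H₂H₃ = 1` relation), whence `|G| = |D₁||D₂||S|`.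
-/

set_option linter.dupNamespace false

noncomputable section

open scoped BigOperators Classical
open Summit.MatrixMultiplication.MatrixMultiplication.Theorems.LieRankDesigns.Negative
  (GLm Mat fourierFn)
open Summit.MatrixMultiplication.MatrixMultiplication.Theorems.LevelOneGL2Designs.Negative
  (levelSubmodule mem_levelSubmodule_iff fourierFn_mem_levelSubmodule levelSubmodule_bi_inv)

namespace Summit.MatrixMultiplication.MatrixMultiplication.Theorems.SubgroupIdentityDesigns.Negative

section TorusBudget

open Literature.Barriers.MatrixMultiplication (SubgroupTPP)

variable {p : ℕ} [hp : Fact p.Prime]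

/-- Entries of a product whose right factor is upper triangular. -/
theorem entries_mul_upper (a b : GLm p 2) (hb : (b : Mat p 2) 1 0 = 0) :
    ((a * b : GLm p 2) : Mat p 2) 0 0 = (a : Mat p 2) 0 0 * (b : Mat p 2) 0 0 ∧
    ((a * b : GLm p 2) : Mat p 2) 1 0 = (a : Mat p 2) 1 0 * (b : Mat p 2) 0 0 ∧
    ((a * b : GLm p 2) : Mat p 2) 1 1 =
      (a : Mat p 2) 1 0 * (b : Mat p 2) 0 1 + (a : Mat p 2) 1 1 * (b : Mat p 2) 1 1 := by
  refine ⟨?_, ?_, ?_⟩ <;> simp [Units.val_mul, Matrix.mul_apply, Fin.sum_univ_two, hb]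

/-- Entries of a product whose left factor is diagonal. -/
theorem entries_diag_mul (d w : GLm p 2) (hd01 : (d : Mat p 2) 0 1 = 0)
    (hd10 : (d : Mat p 2) 1 0 = 0) (i j : Fin 2) :
    ((d * w : GLm p 2) : Mat p 2) i j = (d : Mat p 2) i i * (w : Mat p 2) i j := by
  fin_cases i <;> fin_cases j <;>
    simp [Units.val_mul, Matrix.mul_apply, Fin.sum_univ_two, hd01, hd10]

/-- Entries of a product whose right factor is diagonal. -/
theorem entries_mul_diag (w d : GLm p 2) (hd01 : (d : Mat p 2) 0 1 = 0)
    (hd10 : (d : Mat p 2) 1 0 = 0) (i j : Fin 2) :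
    ((w * d : GLm p 2) : Mat p 2) i j = (w : Mat p 2) i j * (d : Mat p 2) j j := by
  fin_cases i <;> fin_cases j <;>
    simp [Units.val_mul, Matrix.mul_apply, Fin.sum_univ_two, hd01, hd10]

/-- Diagonal invertible matrices commute. -/
theorem comm_of_diag {d e : GLm p 2} (hd01 : (d : Mat p 2) 0 1 = 0) (hd10 : (d : Mat p 2) 1 0 = 0)
    (he01 : (e : Mat p 2) 0 1 = 0) (he10 : (e : Mat p 2) 1 0 = 0) : d * e = e * d := by
  apply Units.ext
  ext i j
  rw [entries_diag_mul d e hd01 hd10, entries_diag_mul e d he01 he10]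
  fin_cases i <;> fin_cases j <;> simp [hd01, hd10, he01, he10, mul_comm]

/-- Conjugating a unitriangular element by a diagonal one gives a unitriangular element. -/
theorem unitri_conj_diag {d v : GLm p 2} (hd01 : (d : Mat p 2) 0 1 = 0)
    (hd10 : (d : Mat p 2) 1 0 = 0) (hv10 : (v : Mat p 2) 1 0 = 0) (hv00 : (v : Mat p 2) 0 0 = 1)
    (hv11 : (v : Mat p 2) 1 1 = 1) :
    ((d⁻¹ * v * d : GLm p 2) : Mat p 2) 1 0 = 0 ∧ ((d⁻¹ * v * d : GLm p 2) : Mat p 2) 0 0 = 1 ∧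
      ((d⁻¹ * v * d : GLm p 2) : Mat p 2) 1 1 = 1 := by
  have hd := diag_ne_zero_of_upper hd10
  set w : GLm p 2 := d⁻¹ * v * d with hw
  have hdw : d * w = v * d := by rw [hw]; group
  have key : ∀ i j : Fin 2, (d : Mat p 2) i i * (w : Mat p 2) i j =
      (v : Mat p 2) i j * (d : Mat p 2) j j := by
    intro i j
    rw [← entries_diag_mul d w hd01 hd10, ← entries_mul_diag v d hd01 hd10, hdw]
  have k10 := key 1 0
  have k00 := key 0 0
  have k11 := key 1 1
  rw [hv10, zero_mul] at k10
  rw [hv00, one_mul] at k00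
  rw [hv11, one_mul] at k11
  refine ⟨?_, ?_, ?_⟩
  · exact (mul_eq_zero.mp k10).resolve_left hd.2
  · exact mul_left_cancel₀ hd.1 (by rw [k00, mul_one])
  · exact mul_left_cancel₀ hd.2 (by rw [k11, mul_one])

/-- Two upper-triangular elements with the same diagonal differ by a unitriangular left factor. -/
theorem unitri_of_mul_eq {v P P' : GLm p 2} (h : v * P = P') (hP : (P : Mat p 2) 1 0 = 0)
    (hP' : (P' : Mat p 2) 1 0 = 0) (h00 : (P' : Mat p 2) 0 0 = (P : Mat p 2) 0 0)
    (h11 : (P' : Mat p 2) 1 1 = (P : Mat p 2) 1 1) :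
    (v : Mat p 2) 1 0 = 0 ∧ (v : Mat p 2) 0 0 = 1 ∧ (v : Mat p 2) 1 1 = 1 := by
  have hPd := diag_ne_zero_of_upper hP
  obtain ⟨e00, e10, e11⟩ := entries_mul_upper v P hP
  rw [h] at e00 e10 e11
  have hv10 : (v : Mat p 2) 1 0 = 0 := by
    rw [hP'] at e10
    exact (mul_eq_zero.mp e10.symm).resolve_right hPd.1
  refine ⟨hv10, ?_, ?_⟩
  · exact (mul_left_injective₀ hPd.1 (by simpa [h00] using e00.symm : _))
  · rw [hv10, zero_mul, zero_add, h11] at e11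
    exact mul_right_cancel₀ hPd.2 (by rw [← e11, one_mul])

/-- **Borel factorisation rigidity under the subgroup TPP.**  With `U⁺ ≤ H₁`: if `d₁, d₁' ∈ H₁` and
`d₂, d₂' ∈ H₂` are diagonal, `s, s' ∈ H₃` are upper triangular, and the triple products
`d₁ d₂ s`, `d₁' d₂' s'` have the same diagonal, then `d₁ = d₁'`, `d₂ = d₂'`, `s = s'`. -/
theorem diag_triple_injective {H₁ H₂ H₃ : Subgroup (GLm p 2)} (htpp : SubgroupTPP H₁ H₂ H₃)
    (hU : ∀ u : GLm p 2, (u : Mat p 2) 1 0 = 0 → (u : Mat p 2) 0 0 = 1 → (u : Mat p 2) 1 1 = 1 →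
      u ∈ H₁)
    {d₁ d₁' d₂ d₂' s s' : GLm p 2} (hd₁ : d₁ ∈ H₁) (hd₁' : d₁' ∈ H₁) (hd₂ : d₂ ∈ H₂)
    (hd₂' : d₂' ∈ H₂) (hs : s ∈ H₃) (hs' : s' ∈ H₃)
    (g₁ : (d₁ : Mat p 2) 0 1 = 0 ∧ (d₁ : Mat p 2) 1 0 = 0)
    (g₁' : (d₁' : Mat p 2) 0 1 = 0 ∧ (d₁' : Mat p 2) 1 0 = 0)
    (g₂ : (d₂ : Mat p 2) 0 1 = 0 ∧ (d₂ : Mat p 2) 1 0 = 0)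
    (g₂' : (d₂' : Mat p 2) 0 1 = 0 ∧ (d₂' : Mat p 2) 1 0 = 0)
    (gs : (s : Mat p 2) 1 0 = 0) (gs' : (s' : Mat p 2) 1 0 = 0)
    (h00 : (d₁ : Mat p 2) 0 0 * (d₂ : Mat p 2) 0 0 * (s : Mat p 2) 0 0 =
      (d₁' : Mat p 2) 0 0 * (d₂' : Mat p 2) 0 0 * (s' : Mat p 2) 0 0)
    (h11 : (d₁ : Mat p 2) 1 1 * (d₂ : Mat p 2) 1 1 * (s : Mat p 2) 1 1 =
      (d₁' : Mat p 2) 1 1 * (d₂' : Mat p 2) 1 1 * (s' : Mat p 2) 1 1) :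
    d₁ = d₁' ∧ d₂ = d₂' ∧ s = s' := by
  -- entries of the two triple products
  have hP : ∀ {a b c : GLm p 2}, (a : Mat p 2) 0 1 = 0 ∧ (a : Mat p 2) 1 0 = 0 →
      (b : Mat p 2) 0 1 = 0 ∧ (b : Mat p 2) 1 0 = 0 → (c : Mat p 2) 1 0 = 0 →
      ((a * b * c : GLm p 2) : Mat p 2) 1 0 = 0 ∧
        ((a * b * c : GLm p 2) : Mat p 2) 0 0 = (a : Mat p 2) 0 0 * (b : Mat p 2) 0 0 *
          (c : Mat p 2) 0 0 ∧
        ((a * b * c : GLm p 2) : Mat p 2) 1 1 = (a : Mat p 2) 1 1 * (b : Mat p 2) 1 1 *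
          (c : Mat p 2) 1 1 := by
    intro a b c ha hb hc
    have hab10 : ((a * b : GLm p 2) : Mat p 2) 1 0 = 0 := by
      rw [entries_diag_mul a b ha.1 ha.2, hb.2, mul_zero]
    obtain ⟨e00, e10, e11⟩ := entries_mul_upper (a * b) c hc
    refine ⟨by rw [e10, hab10, zero_mul], by rw [e00, entries_diag_mul a b ha.1 ha.2], ?_⟩
    rw [e11, hab10, zero_mul, zero_add, entries_diag_mul a b ha.1 ha.2]
  obtain ⟨P10, P00, P11⟩ := hP g₁ g₂ gs
  obtain ⟨Q10, Q00, Q11⟩ := hP g₁' g₂' gs'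
  -- the unitriangular discrepancy `v`, `v (d₁ d₂ s) = d₁' d₂' s'`
  set v : GLm p 2 := d₁' * d₂' * s' * (d₁ * d₂ * s)⁻¹ with hv
  have hvP : v * (d₁ * d₂ * s) = d₁' * d₂' * s' := by rw [hv]; group
  obtain ⟨v10, v00, v11⟩ :=
    unitri_of_mul_eq hvP P10 Q10 (by rw [Q00, P00, h00]) (by rw [Q11, P11, h11])
  -- the relation `x y z = 1` with `x ∈ H₁`, `y ∈ H₂`, `z ∈ H₃`
  obtain ⟨w10, w00, w11⟩ := unitri_conj_diag g₂'.1 g₂'.2 v10 v00 v11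
  have hx : d₁'⁻¹ * (d₂'⁻¹ * v * d₂') * d₁ ∈ H₁ :=
    H₁.mul_mem (H₁.mul_mem (H₁.inv_mem hd₁') (hU _ w10 w00 w11)) hd₁
  have hy : d₂'⁻¹ * d₂ ∈ H₂ := H₂.mul_mem (H₂.inv_mem hd₂') hd₂
  have hz : s * s'⁻¹ ∈ H₃ := H₃.mul_mem hs (H₃.inv_mem hs')
  have hc1 : d₂' * d₁ = d₁ * d₂' := comm_of_diag g₂'.1 g₂'.2 g₁.1 g₁.2
  have hc2 : d₂'⁻¹ * d₁' = d₁' * d₂'⁻¹ := by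
    have h := comm_of_diag g₂'.1 g₂'.2 g₁'.1 g₁'.2
    calc d₂'⁻¹ * d₁' = d₂'⁻¹ * (d₁' * d₂') * d₂'⁻¹ := by group
      _ = d₂'⁻¹ * (d₂' * d₁') * d₂'⁻¹ := by rw [h]
      _ = d₁' * d₂'⁻¹ := by group
  have hrel : d₁'⁻¹ * (d₂'⁻¹ * v * d₂') * d₁ * (d₂'⁻¹ * d₂) * (s * s'⁻¹) = 1 := by
    calc d₁'⁻¹ * (d₂'⁻¹ * v * d₂') * d₁ * (d₂'⁻¹ * d₂) * (s * s'⁻¹)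
        = d₁'⁻¹ * d₂'⁻¹ * v * (d₂' * d₁ * d₂'⁻¹) * d₂ * s * s'⁻¹ := by group
      _ = d₁'⁻¹ * d₂'⁻¹ * v * d₁ * d₂ * s * s'⁻¹ := by rw [hc1, mul_inv_cancel_right]
      _ = d₁'⁻¹ * d₂'⁻¹ * (v * (d₁ * d₂ * s)) * s'⁻¹ := by group
      _ = d₁'⁻¹ * (d₂'⁻¹ * d₁') * d₂' * s' * s'⁻¹ := by rw [hvP]; group
      _ = 1 := by rw [hc2]; group
  obtain ⟨-, hy1, hz1⟩ := htpp _ hx _ hy _ hz hrel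
  have e₂ : d₂ = d₂' := (inv_mul_eq_one.mp hy1).symm
  have e₃ : s = s' := mul_inv_eq_one.mp hz1
  refine ⟨?_, e₂, e₃⟩
  -- finally `d₁ = d₁'` from the diagonal equalities
  subst e₂ e₃
  have n₂ := diag_ne_zero_of_upper g₂.2
  have n₃ := diag_ne_zero_of_upper gs
  have f00 : (d₁ : Mat p 2) 0 0 = (d₁' : Mat p 2) 0 0 :=
    mul_right_cancel₀ n₂.1 (mul_right_cancel₀ n₃.1 h00)
  have f11 : (d₁ : Mat p 2) 1 1 = (d₁' : Mat p 2) 1 1 :=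
    mul_right_cancel₀ n₂.2 (mul_right_cancel₀ n₃.2 h11)
  apply Units.ext
  ext i j
  fin_cases i <;> fin_cases j <;> simp [g₁.1, g₁.2, g₁'.1, g₁'.2, f00, f11]

/-- The diagonal of an upper-triangular subgroup as a homomorphism to `𝔽ₚˣ × 𝔽ₚˣ` (existence). -/
theorem exists_diagHom (K : Subgroup (GLm p 2)) (hK : ∀ k ∈ K, (k : Mat p 2) 1 0 = 0) :
    ∃ φ : K →* (ZMod p)ˣ × (ZMod p)ˣ, ∀ k : K,
      ((φ k).1 : ZMod p) = ((k : GLm p 2) : Mat p 2) 0 0 ∧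
        ((φ k).2 : ZMod p) = ((k : GLm p 2) : Mat p 2) 1 1 := by
  refine ⟨{ toFun := fun k => (Units.mk0 _ (diag_ne_zero_of_upper (hK _ k.2)).1,
              Units.mk0 _ (diag_ne_zero_of_upper (hK _ k.2)).2),
            map_one' := ?_, map_mul' := ?_ }, fun k => ⟨rfl, rfl⟩⟩
  · ext <;> simp
  · intro k k'
    obtain ⟨e00, -, e11⟩ := entries_mul_upper (k : GLm p 2) k' (hK _ k'.2)
    rw [hK _ k.2, zero_mul, zero_add] at e11
    ext <;> simp [e00, e11]

/-- **TORUS BUDGET.**  Subgroup TPP with `U⁺ ≤ H₁`, diagonal subgroups `D₁ ≤ H₁`, `D₂ ≤ H₂`, an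
upper-triangular subgroup `S ≤ H₃`, and a level-1 identity test force `|D₁|·|D₂|·|S| ≤ p - 1`. -/
theorem torus_budget {H₁ H₂ H₃ : Subgroup (GLm p 2)} (htpp : SubgroupTPP H₁ H₂ H₃)
    (hU : ∀ u : GLm p 2, (u : Mat p 2) 1 0 = 0 → (u : Mat p 2) 0 0 = 1 → (u : Mat p 2) 1 1 = 1 →
      u ∈ H₁)
    {D₁ D₂ S : Subgroup (GLm p 2)} (hD₁ : D₁ ≤ H₁) (hD₂ : D₂ ≤ H₂) (hS : S ≤ H₃)
    (hd₁ : ∀ d ∈ D₁, (d : Mat p 2) 0 1 = 0 ∧ (d : Mat p 2) 1 0 = 0)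
    (hd₂ : ∀ d ∈ D₂, (d : Mat p 2) 0 1 = 0 ∧ (d : Mat p 2) 1 0 = 0)
    (hs : ∀ s ∈ S, (s : Mat p 2) 1 0 = 0)
    (hdesign : ∃ f ∈ levelSubmodule p 2 1, f 1 = 1 ∧
      ∀ a ∈ H₁, ∀ b ∈ H₂, ∀ c ∈ H₃, a * b * c ≠ 1 → f (a * b * c) = 0) :
    Nat.card D₁ * Nat.card D₂ * Nat.card S ≤ p - 1 := by
  by_contra hlt
  rw [not_le] at hlt
  obtain ⟨φ₁, hφ₁⟩ := exists_diagHom D₁ fun d hd => (hd₁ d hd).2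
  obtain ⟨φ₂, hφ₂⟩ := exists_diagHom D₂ fun d hd => (hd₂ d hd).2
  obtain ⟨φ₃, hφ₃⟩ := exists_diagHom S hs
  set G : Subgroup ((ZMod p)ˣ × (ZMod p)ˣ) := φ₁.range ⊔ φ₂.range ⊔ φ₃.range with hG
  -- entries of a triple product `d₁ d₂ s`
  have hP : ∀ (d₁ : D₁) (d₂ : D₂) (s : S),
      (((d₁ : GLm p 2) * (d₂ : GLm p 2) * (s : GLm p 2) : GLm p 2) : Mat p 2) 1 0 = 0 ∧
        (((d₁ : GLm p 2) * (d₂ : GLm p 2) * (s : GLm p 2) : GLm p 2) : Mat p 2) 0 0 =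
          ((d₁ : GLm p 2) : Mat p 2) 0 0 * ((d₂ : GLm p 2) : Mat p 2) 0 0 *
            ((s : GLm p 2) : Mat p 2) 0 0 ∧
        (((d₁ : GLm p 2) * (d₂ : GLm p 2) * (s : GLm p 2) : GLm p 2) : Mat p 2) 1 1 =
          ((d₁ : GLm p 2) : Mat p 2) 1 1 * ((d₂ : GLm p 2) : Mat p 2) 1 1 *
            ((s : GLm p 2) : Mat p 2) 1 1 := by
    intro d₁ d₂ s
    have g₁ := hd₁ _ d₁.2
    have g₂ := hd₂ _ d₂.2
    have hab10 : (((d₁ : GLm p 2) * (d₂ : GLm p 2) : GLm p 2) : Mat p 2) 1 0 = 0 := by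
      rw [entries_diag_mul _ _ g₁.1 g₁.2, g₂.2, mul_zero]
    obtain ⟨e00, e10, e11⟩ :=
      entries_mul_upper ((d₁ : GLm p 2) * (d₂ : GLm p 2)) (s : GLm p 2) (hs _ s.2)
    refine ⟨by rw [e10, hab10, zero_mul], by rw [e00, entries_diag_mul _ _ g₁.1 g₁.2], ?_⟩
    rw [e11, hab10, zero_mul, zero_add, entries_diag_mul _ _ g₁.1 g₁.2]
  -- every element of `G` is the diagonal of an upper-triangular triple product
  have hGreal : ∀ g ∈ G, ∃ y : ZMod p, ∃ a ∈ H₁, ∃ b ∈ H₂, ∃ c ∈ H₃,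
      ((a * b * c : GLm p 2) : Mat p 2) =
        !![((g.1 : (ZMod p)ˣ) : ZMod p), y; 0, (g.2 : ZMod p)] := by
    intro g hg
    obtain ⟨x12, hx12, x3, hx3, rfl⟩ := Subgroup.mem_sup.mp hg
    obtain ⟨x1, hx1, x2, hx2, rfl⟩ := Subgroup.mem_sup.mp hx12
    obtain ⟨d₁, rfl⟩ := MonoidHom.mem_range.mp hx1
    obtain ⟨d₂, rfl⟩ := MonoidHom.mem_range.mp hx2
    obtain ⟨s, rfl⟩ := MonoidHom.mem_range.mp hx3
    obtain ⟨P10, P00, P11⟩ := hP d₁ d₂ s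
    refine ⟨(((d₁ : GLm p 2) * (d₂ : GLm p 2) * (s : GLm p 2) : GLm p 2) : Mat p 2) 0 1, d₁,
      hD₁ d₁.2, d₂, hD₂ d₂.2, s, hS s.2, ?_⟩
    ext i j
    fin_cases i <;> fin_cases j <;>
      simp [P10, P00, P11, (hφ₁ d₁).1, (hφ₁ d₁).2, (hφ₂ d₂).1, (hφ₂ d₂).2, (hφ₃ s).1, (hφ₃ s).2]
  -- `|G| ≥ |D₁| |D₂| |S|` by the TPP rigidity
  have hmem : ∀ (d₁ : D₁) (d₂ : D₂) (s : S), φ₁ d₁ * φ₂ d₂ * φ₃ s ∈ G := fun d₁ d₂ s =>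
    G.mul_mem (G.mul_mem (Subgroup.mem_sup_left (Subgroup.mem_sup_left ⟨d₁, rfl⟩))
      (Subgroup.mem_sup_left (Subgroup.mem_sup_right ⟨d₂, rfl⟩))) (Subgroup.mem_sup_right ⟨s, rfl⟩)
  let Ψ : D₁ × D₂ × S → G := fun q => ⟨φ₁ q.1 * φ₂ q.2.1 * φ₃ q.2.2, hmem q.1 q.2.1 q.2.2⟩
  have hΨ : Function.Injective Ψ := by
    rintro ⟨d₁, d₂, s⟩ ⟨d₁', d₂', s'⟩ e
    have e' : φ₁ d₁ * φ₂ d₂ * φ₃ s = φ₁ d₁' * φ₂ d₂' * φ₃ s' := congrArg Subtype.val e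
    have e1 := congrArg (fun g : (ZMod p)ˣ × (ZMod p)ˣ => ((g.1 : (ZMod p)ˣ) : ZMod p)) e'
    have e2 := congrArg (fun g : (ZMod p)ˣ × (ZMod p)ˣ => ((g.2 : (ZMod p)ˣ) : ZMod p)) e'
    simp only [Prod.fst_mul, Prod.snd_mul, Units.val_mul, (hφ₁ _).1, (hφ₁ _).2, (hφ₂ _).1,
      (hφ₂ _).2, (hφ₃ _).1, (hφ₃ _).2] at e1 e2
    obtain ⟨f₁, f₂, f₃⟩ := diag_triple_injective htpp hU (hD₁ d₁.2) (hD₁ d₁'.2) (hD₂ d₂.2)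
      (hD₂ d₂'.2) (hS s.2) (hS s'.2) (hd₁ _ d₁.2) (hd₁ _ d₁'.2) (hd₂ _ d₂.2) (hd₂ _ d₂'.2)
      (hs _ s.2) (hs _ s'.2) e1 e2
    simp only [Prod.mk.injEq]
    exact ⟨Subtype.ext f₁, Subtype.ext f₂, Subtype.ext f₃⟩
  have hcard : p - 1 < Nat.card G :=
    calc p - 1 < Nat.card D₁ * Nat.card D₂ * Nat.card S := hlt
      _ = Nat.card (D₁ × D₂ × S) := by rw [Nat.card_prod, Nat.card_prod, mul_assoc]
      _ ≤ Nat.card G := Nat.card_le_card_of_injective Ψ hΨ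
  exact no_idTest_of_diag_subgroup hU G hGreal hcard hdesign

/-- **TORUS BUDGET** in the crux's vocabulary (level-≤-1 Fourier coefficient functions). -/
theorem torus_budget_levelOne {H₁ H₂ H₃ : Subgroup (GLm p 2)} (htpp : SubgroupTPP H₁ H₂ H₃)
    (hU : ∀ u : GLm p 2, (u : Mat p 2) 1 0 = 0 → (u : Mat p 2) 0 0 = 1 → (u : Mat p 2) 1 1 = 1 →
      u ∈ H₁)
    {D₁ D₂ S : Subgroup (GLm p 2)} (hD₁ : D₁ ≤ H₁) (hD₂ : D₂ ≤ H₂) (hS : S ≤ H₃)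
    (hd₁ : ∀ d ∈ D₁, (d : Mat p 2) 0 1 = 0 ∧ (d : Mat p 2) 1 0 = 0)
    (hd₂ : ∀ d ∈ D₂, (d : Mat p 2) 0 1 = 0 ∧ (d : Mat p 2) 1 0 = 0)
    (hs : ∀ s ∈ S, (s : Mat p 2) 1 0 = 0)
    (hdesign : ∃ c : Mat p 2 → ℂ, (∀ M, 1 < M.rank → c M = 0) ∧
      (∑ M, c M * ZMod.stdAddChar (Matrix.trace (M * ((1 : GLm p 2) : Mat p 2)))) = 1 ∧
      ∀ a ∈ H₁, ∀ b ∈ H₂, ∀ g ∈ H₃, a * b * g ≠ 1 →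
        (∑ M, c M *
          ZMod.stdAddChar (Matrix.trace (M * ((a * b * g : GLm p 2) : Mat p 2)))) = 0) :
    Nat.card D₁ * Nat.card D₂ * Nat.card S ≤ p - 1 := by
  obtain ⟨c, hc, hc1, hc0⟩ := hdesign
  exact torus_budget htpp hU hD₁ hD₂ hS hd₁ hd₂ hs
    ⟨fourierFn c, fourierFn_mem_levelSubmodule hc, hc1, fun a ha b hb g hg hne =>
      hc0 a ha b hb g hg hne⟩

end TorusBudget

end Summit.MatrixMultiplication.MatrixMultiplication.Theorems.SubgroupIdentityDesigns.Negative

end
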